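import Summits.Langlands.Langlands.Theses.SenNullAlignment

/-!
# Rattack position file — `SenNullAlignment.SectorComplement` (stmt-Langlands-16308) — published as `Cruxes/SectorComplement/Rattack_SenNullAlignment.lean`

Refuter crux-attack seat `refuter-rattack-stmt-Langlands-16308-0`, 2026-08-17. Independent re-derivation (not an import) of
the logical position recorded by the strategist in `Cruxes/SectorComplement/Position_SenNullAlignment.lean`, plus the
load-bearing / vacuity bookkeeping a refuter owes: C has ONE hypothesis X; C-without-X is the summit; ¬X would refute the
summit; ¬C is exactly X ∧ ¬summit. Nothing here asserts C, X or the summit. No sorry.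
-/

set_option linter.dupNamespace false

namespace Summit.Langlands.Langlands.Cruxes.SectorComplement.RattackSNA

open Summit.Langlands.Langlands.Theses.SenNullAlignment

/-- Readback. [folklore] -/
theorem sectorComplement_iff_imp : SectorComplement ↔ (OddHilbertReciprocity → _root_.Langlands) := Iff.rfl

/-- Probe `S → C`: trivial (discard the sector hypothesis) — expected of a junction item. [folklore] -/
theorem sectorComplement_of_langlands : _root_.Langlands → SectorComplement := fun h _ ↦ h

/-- The route target is a FORMAL COROLLARY of the summit as typed (`∃ RD` from the non-vacuity conjunct, (A) at `n = 2`;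
holomorphy / oddness / total reality unused). [folklore] -/
theorem oddHilbertReciprocity_of_langlands : _root_.Langlands → OddHilbertReciprocity := by
  intro h K _ _ _hK
  obtain ⟨⟨RD⟩, hall⟩ := h K
  refine ⟨RD, ?_⟩
  intro hcpt π k w hL _hhol _hodd ℓ _ ι
  obtain ⟨ρ, hirr, hgeo, hcorr, -⟩ := (hall RD 2 two_pos hcpt).1 π hL ℓ ι
  exact ⟨ρ, hirr, hgeo, hcorr⟩

/-- Exact bookkeeping identity: the route is the bridge split of the summit. [folklore] -/
theorem langlands_iff_target_and_sectorComplement :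
    _root_.Langlands ↔ OddHilbertReciprocity ∧ SectorComplement :=
  ⟨fun h ↦ ⟨oddHilbertReciprocity_of_langlands h, fun _ ↦ h⟩, fun h ↦ h.2 h.1⟩

/-- Probe `C → S`: holds EXACTLY under X (so C restates the summit iff X is provable; X is open). [folklore] -/
theorem sectorComplement_imp_langlands_iff :
    (SectorComplement → _root_.Langlands) ↔ (OddHilbertReciprocity ∨ _root_.Langlands) := by
  constructor
  · intro h
    by_cases hX : OddHilbertReciprocity
    · exact Or.inl hX
    · exact Or.inr (h fun x ↦ absurd x hX)
  · rintro (hX | hL) hC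
    · exact hC hX
    · exact hL

/-- Exact content of a refutation of C: prove the open sector theorem X AND refute the audited summit. [folklore] -/
theorem not_sectorComplement_iff : ¬ SectorComplement ↔ OddHilbertReciprocity ∧ ¬ _root_.Langlands :=
  Classical.not_imp

/-- Vacuity route to C: if X were refutable, C would close ex falso … [folklore] -/
theorem sectorComplement_of_not_target : ¬ OddHilbertReciprocity → SectorComplement := fun h x ↦ absurd x h

/-- … but refuting X refutes the summit (X is a corollary of it), so X is junk-refutable only if `Langlands` is. [folklore] -/
theorem not_langlands_of_not_target : ¬ OddHilbertReciprocity → ¬ _root_.Langlands :=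
  mt oddHilbertReciprocity_of_langlands

/-- LOAD-BEARING ANALYSIS: C with its only hypothesis X dropped. -/
def SectorComplementWithoutTarget : Prop := _root_.Langlands

/-- … is the summit itself, so the protocol's `_false_without_X` lemma would be `¬ Langlands` (unavailable). [folklore] -/
theorem sectorComplementWithoutTarget_iff : SectorComplementWithoutTarget ↔ _root_.Langlands := Iff.rfl

/-- Truth table. [folklore] -/
theorem sectorComplement_iff_not_or : SectorComplement ↔ ¬ OddHilbertReciprocity ∨ _root_.Langlands := imp_iff_not_or

/-- Under the six other binders of the route's deciding theorem, C IS the summit (costume-under-cruxes, by design of a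
junction item): restated through `closes` itself. [folklore] -/
theorem sectorComplement_iff_langlands_of_cruxes (h1 : SingularProjectiveFinite) (h2 : NonAlignedAtEll)
    (h3 : AlignedAtEll) (h4 : AwayFromEll) (hA : OddNonRegularAttached) (hR : RegularServed) :
    SectorComplement ↔ _root_.Langlands :=
  ⟨fun hC ↦ closes h1 h2 h3 h4 hA hR hC, fun h _ ↦ h⟩

end Summit.Langlands.Langlands.Cruxes.SectorComplement.RattackSNA
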